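import Summits.AtomisticToContinuum.BoseEinsteinCondensation.Theorems.BECInfDivCoherenceLevyMassCondensationFourier

/-!
# Route BECInfDivCoherence — `LevyMassCondensation`: the Lévy-mass bound on the grid

Helper file (supports `stmt-AtomisticToContinuum-9117`), continuing
`BECInfDivCoherenceLevyMassCondensationFourier.lean`:

* `jordan_grid` — `Σ_a (1 - cos(2π q_a/m)) ≥ (8/m²) Σ_a q̄_a²`, `q̄_a = min(q_a, m - q_a)`
  (Jordan's inequality);
* `levyMass_le` — the Lévy-mass bound `Σ_{q≠0} ν⁺_q ≤ π²/(2h²)(A + 6εm³) + C` from the f-sum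
  `≤ A`, a floor `ν ≥ -ε` and a `(-1)`-moment bound `≤ C`;
* `sum_eq_zero_add_sum_filter`, `exp_mean_log_le_mean` (AM–GM), `latticeVec_single_one`,
  `latticeVec_single_neg_one` — small bookkeeping used by the glue.

References: Berg–Christensen–Ressel, *Harmonic Analysis on Semigroups* (GTM 100), Ch. 3–4.
-/

noncomputable section

namespace Summit.AtomisticToContinuum.BoseEinsteinCondensation.Theorems.InfDivGlue

open Finset Literature.MathematicalPhysics.QuantumManyBody.BoseGas

variable {m : ℕ} [NeZero m]

/-! ### Jordan's inequality on the grid -/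

/-- `1 - cos(2π t/m) ≥ 8 (min(t, m-t))²/m²` for `t < m` (Jordan's inequality
`sin x ≥ 2x/π` on `[0, π/2]`). [folklore] -/
theorem jordan_coord {t : ℕ} (ht : t < m) :
    8 / (m : ℝ) ^ 2 * ((min t (m - t) : ℕ) : ℝ) ^ 2 ≤
      1 - Real.cos (2 * Real.pi * (t : ℝ) / m) := by
  have hmpos : (0 : ℝ) < m := by exact_mod_cast Nat.pos_of_ne_zero (NeZero.ne m)
  -- reduce to `r = min t (m-t) ≤ m/2` with `cos(2πt/m) = cos(2πr/m)`
  set r : ℕ := min t (m - t) with hr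
  have hr2 : 2 * (r : ℝ) ≤ m := by
    have : 2 * r ≤ m := by omega
    exact_mod_cast this
  have hcos : Real.cos (2 * Real.pi * (t : ℝ) / m) = Real.cos (2 * Real.pi * (r : ℝ) / m) := by
    by_cases h : t ≤ m - t
    · rw [hr, min_eq_left h]
    · rw [hr, min_eq_right (by omega)]
      have : (((m - t : ℕ)) : ℝ) = m - t := by
        rw [Nat.cast_sub ht.le]
      rw [this, show 2 * Real.pi * ((m : ℝ) - t) / m = -(2 * Real.pi * (t : ℝ) / m) + 2 * Real.pi by
        field_simp; ring, Real.cos_add_two_pi, Real.cos_neg]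
  rw [hcos]
  -- `1 - cos(2x) = 2 sin² x` with `x = π r/m ∈ [0, π/2]`
  set x : ℝ := Real.pi * r / m with hx
  have h2x : 2 * Real.pi * (r : ℝ) / m = 2 * x := by rw [hx]; ring
  rw [h2x, Real.cos_two_mul]
  have hx0 : 0 ≤ x := by positivity
  have hxle : x ≤ Real.pi / 2 := by
    rw [hx, div_le_div_iff₀ hmpos two_pos]
    nlinarith [Real.pi_pos]
  have hsin := Real.mul_le_sin hx0 hxle
  have hsin0 : 0 ≤ 2 / Real.pi * x := by positivity
  have hsq : (2 / Real.pi * x) ^ 2 ≤ Real.sin x ^ 2 := pow_le_pow_left₀ hsin0 hsin 2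
  have hval : 2 / Real.pi * x = 2 * r / m := by
    rw [hx]; field_simp
  rw [hval] at hsq
  have hcs := Real.sin_sq_add_cos_sq x
  have : 8 / (m : ℝ) ^ 2 * (r : ℝ) ^ 2 = 2 * (2 * r / m) ^ 2 := by
    field_simp; ring
  rw [this]
  nlinarith

/-- **Jordan on the grid**: `Σ_a (1 - cos(2π q_a/m)) ≥ (8/m²) Σ_a q̄_a²`. [folklore] -/
theorem jordan_grid (q : Fin 3 → Fin m) :
    8 / (m : ℝ) ^ 2 * ∑ a, ((min (q a : ℕ) (m - (q a : ℕ)) : ℕ) : ℝ) ^ 2 ≤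
      ∑ a, (1 - Real.cos (2 * Real.pi * ((q a : ℕ) : ℝ) / m)) := by
  rw [Finset.mul_sum]
  exact Finset.sum_le_sum fun a _ => jordan_coord (q a).isLt

omit [NeZero m] in
/-- `Σ_a (1 - cos(2π q_a/m)) ≤ 6`. [folklore] -/
theorem fsumWeight_le_six (q : Fin 3 → Fin m) :
    ∑ a, (1 - Real.cos (2 * Real.pi * ((q a : ℕ) : ℝ) / m)) ≤ 6 := by
  calc ∑ a : Fin 3, (1 - Real.cos (2 * Real.pi * ((q a : ℕ) : ℝ) / m)) ≤ ∑ _a : Fin 3, (2 : ℝ) :=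
        Finset.sum_le_sum fun a _ => by linarith [Real.neg_one_le_cos (2 * Real.pi * ((q a : ℕ) : ℝ) / m)]
    _ = 6 := by norm_num

omit [NeZero m] in
/-- `Σ_a (1 - cos(2π q_a/m)) ≥ 0`. [folklore] -/
theorem fsumWeight_nonneg (q : Fin 3 → Fin m) :
    0 ≤ ∑ a, (1 - Real.cos (2 * Real.pi * ((q a : ℕ) : ℝ) / m)) :=
  Finset.sum_nonneg fun a _ => by linarith [Real.cos_le_one (2 * Real.pi * ((q a : ℕ) : ℝ) / m)]

omit [NeZero m] in
/-- For `q ≠ 0` on the grid the centred norm is `≥ 1`. [folklore] -/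
theorem one_le_sum_centred_sq {q : Fin 3 → Fin m} (hq : ∃ k, (q k : ℕ) ≠ 0) :
    (1 : ℝ) ≤ ∑ a, ((min (q a : ℕ) (m - (q a : ℕ)) : ℕ) : ℝ) ^ 2 := by
  obtain ⟨k, hk⟩ := hq
  have hlt := (q k).isLt
  have h1 : (1 : ℝ) ≤ ((min (q k : ℕ) (m - (q k : ℕ)) : ℕ) : ℝ) ^ 2 := by
    have : 1 ≤ min (q k : ℕ) (m - (q k : ℕ)) := by omega
    have h' : (1 : ℝ) ≤ ((min (q k : ℕ) (m - (q k : ℕ)) : ℕ) : ℝ) := by exact_mod_cast this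
    nlinarith
  exact h1.trans (Finset.single_le_sum (f := fun a => ((min (q a : ℕ) (m - (q a : ℕ)) : ℕ) : ℝ) ^ 2)
    (fun _ _ => sq_nonneg _) (Finset.mem_univ k))

/-! ### The Lévy-mass bound -/

/-- **Lévy mass from two moments.** If `ν_q ≥ -ε` off `q = 0`, the f-sum
`Σ_q ν_q λ_q ≤ A` (`λ_q = Σ_a (1 - cos(2π q_a/m))`) and the `(-1)`-moment of `ν⁺` is `≤ C`
(`|k_q| = (2π/L)|q̄|`), then `Σ_{q≠0} ν⁺_q ≤ π²/(2h²) (A + 6εm³) + C`, `h = L/m`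
(split `|k_q| ≥ 1`, where `ν⁺ ≤ ν⁺|k|² ≤ (π²/2h²) ν⁺λ` by Jordan, from `|k_q| < 1`, where
`ν⁺ ≤ ν⁺/|k|`). [folklore] -/
theorem levyMass_le (hm : 2 ≤ m) {L : ℝ} (hL : 0 < L) (ν : (Fin 3 → Fin m) → ℝ) {ε A C : ℝ}
    (hε : 0 ≤ ε) (hν : ∀ q : Fin 3 → Fin m, (∃ k, (q k : ℕ) ≠ 0) → -ε ≤ ν q)
    (hA : ∑ q : Fin 3 → Fin m, ν q * (∑ a, (1 - Real.cos (2 * Real.pi * ((q a : ℕ) : ℝ) / m))) ≤ A)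
    (hC : (∑ q : Fin 3 → Fin m with (∃ k, (q k : ℕ) ≠ 0), max (ν q) 0 /
      (2 * Real.pi / L * Real.sqrt (∑ k, ((min (q k : ℕ) (m - (q k : ℕ)) : ℕ) : ℝ) ^ 2))) ≤ C) :
    (∑ q : Fin 3 → Fin m with (∃ k, (q k : ℕ) ≠ 0), max (ν q) 0) ≤
      Real.pi ^ 2 / (2 * (L / m) ^ 2) * (A + 6 * ε * (m : ℝ) ^ 3) + C := by
  have hmpos : (0 : ℝ) < m := by exact_mod_cast (show 0 < m by omega)
  set P := Finset.univ.filter fun q : Fin 3 → Fin m => ∃ k, (q k : ℕ) ≠ 0 with hP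
  -- abbreviations (as functions)
  set lam : (Fin 3 → Fin m) → ℝ := fun q => ∑ a, (1 - Real.cos (2 * Real.pi * ((q a : ℕ) : ℝ) / m))
    with hlam
  set K : (Fin 3 → Fin m) → ℝ := fun q =>
    2 * Real.pi / L * Real.sqrt (∑ k, ((min (q k : ℕ) (m - (q k : ℕ)) : ℕ) : ℝ) ^ 2) with hK
  have hlam0 : ∀ q, 0 ≤ lam q := fun q => fsumWeight_nonneg q
  have hlam6 : ∀ q, lam q ≤ 6 := fun q => fsumWeight_le_six q
  have hKpos : ∀ q ∈ P, 0 < K q := by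
    intro q hq
    rw [hP, Finset.mem_filter] at hq
    have h1 := one_le_sum_centred_sq hq.2
    simp only [hK]
    exact mul_pos (by positivity) (Real.sqrt_pos.2 (by linarith))
  -- (1) the f-sum for positive parts: `Σ_{q∈P} ν⁺ λ ≤ A + 6εm³`
  have hlam_zero : lam 0 = 0 := by
    simp [hlam]
  have h1 : ∑ q ∈ P, max (ν q) 0 * lam q ≤ A + 6 * ε * (m : ℝ) ^ 3 := by
    have hle : ∀ q ∈ P, max (ν q) 0 * lam q ≤ ν q * lam q + ε * lam q := by
      intro q hq
      rw [hP, Finset.mem_filter] at hq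
      have := hν q hq.2
      rw [← add_mul]
      exact mul_le_mul_of_nonneg_right (max_le (by linarith) (by linarith)) (hlam0 q)
    have hsumP : ∑ q ∈ P, ν q * lam q = ∑ q, ν q * lam q := by
      rw [hP, Finset.sum_filter]
      refine Finset.sum_congr rfl fun q _ => ?_
      split_ifs with hq
      · rfl
      · push Not at hq
        have : q = 0 := funext fun k => Fin.ext (hq k)
        rw [this, hlam_zero, mul_zero]
    have hεsum : ∑ q ∈ P, ε * lam q ≤ 6 * ε * (m : ℝ) ^ 3 :=
      calc ∑ q ∈ P, ε * lam q ≤ ∑ q : Fin 3 → Fin m, ε * lam q :=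
            Finset.sum_le_sum_of_subset_of_nonneg (Finset.filter_subset _ _)
              fun q _ _ => mul_nonneg hε (hlam0 q)
        _ ≤ ∑ _q : Fin 3 → Fin m, ε * 6 :=
            Finset.sum_le_sum fun q _ => mul_le_mul_of_nonneg_left (hlam6 q) hε
        _ = 6 * ε * (m : ℝ) ^ 3 := by
            simp only [sum_const, card_univ, Fintype.card_fun, Fintype.card_fin, nsmul_eq_mul,
              Nat.cast_pow]
            ring
    calc ∑ q ∈ P, max (ν q) 0 * lam q ≤ ∑ q ∈ P, (ν q * lam q + ε * lam q) := Finset.sum_le_sum hle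
      _ = ∑ q ∈ P, ν q * lam q + ∑ q ∈ P, ε * lam q := Finset.sum_add_distrib
      _ ≤ A + 6 * ε * (m : ℝ) ^ 3 := by rw [hsumP]; exact add_le_add hA hεsum
  -- (2) pointwise: `ν⁺ ≤ (π²/2h²) ν⁺ λ + ν⁺/K` on `P`
  have h2 : ∀ q ∈ P, max (ν q) 0 ≤
      Real.pi ^ 2 / (2 * (L / m) ^ 2) * (max (ν q) 0 * lam q) + max (ν q) 0 / K q := by
    intro q hq
    have hKq := hKpos q hq
    have hν0 : 0 ≤ max (ν q) 0 := le_max_right _ _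
    have hA0 : 0 ≤ Real.pi ^ 2 / (2 * (L / m) ^ 2) * (max (ν q) 0 * lam q) := by
      have := hlam0 q; positivity
    have hB0 : 0 ≤ max (ν q) 0 / K q := div_nonneg hν0 hKq.le
    by_cases hK1 : 1 ≤ K q
    · -- `ν⁺ ≤ ν⁺ K² ≤ (π²/2h²) ν⁺ λ`
      have hJ := jordan_grid q
      -- `K² = (2π/L)² Σ q̄²`, so `Σ q̄² = K² L²/(4π²)` and `λ ≥ 8/m² · K² L²/(4π²) = 2h²K²/π²`
      have hS0 : 0 ≤ ∑ k, ((min (q k : ℕ) (m - (q k : ℕ)) : ℕ) : ℝ) ^ 2 :=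
        Finset.sum_nonneg fun _ _ => sq_nonneg _
      have hKsq : K q ^ 2 = (2 * Real.pi / L) ^ 2 * ∑ k, ((min (q k : ℕ) (m - (q k : ℕ)) : ℕ) : ℝ) ^ 2 := by
        simp only [hK]; rw [mul_pow, Real.sq_sqrt hS0]
      have hlamK : 2 * (L / m) ^ 2 / Real.pi ^ 2 * K q ^ 2 ≤ lam q := by
        rw [hKsq]
        refine le_trans (le_of_eq ?_) hJ
        field_simp
        ring
      have hK2 : max (ν q) 0 ≤ max (ν q) 0 * K q ^ 2 :=
        le_mul_of_one_le_right hν0 (by nlinarith)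
      calc max (ν q) 0 ≤ max (ν q) 0 * K q ^ 2 := hK2
        _ = Real.pi ^ 2 / (2 * (L / m) ^ 2) * (max (ν q) 0 * (2 * (L / m) ^ 2 / Real.pi ^ 2 * K q ^ 2)) := by
            field_simp
        _ ≤ Real.pi ^ 2 / (2 * (L / m) ^ 2) * (max (ν q) 0 * lam q) := by
            gcongr
        _ ≤ _ := le_add_of_nonneg_right hB0
    · push Not at hK1
      have : max (ν q) 0 ≤ max (ν q) 0 / K q := by
        rw [le_div_iff₀ hKq]; nlinarith
      exact this.trans (le_add_of_nonneg_left hA0)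
  -- (3) sum up
  calc ∑ q ∈ P, max (ν q) 0
      ≤ ∑ q ∈ P, (Real.pi ^ 2 / (2 * (L / m) ^ 2) * (max (ν q) 0 * lam q) + max (ν q) 0 / K q) :=
        Finset.sum_le_sum h2
    _ = Real.pi ^ 2 / (2 * (L / m) ^ 2) * ∑ q ∈ P, max (ν q) 0 * lam q + ∑ q ∈ P, max (ν q) 0 / K q := by
        rw [Finset.sum_add_distrib, Finset.mul_sum]
    _ ≤ Real.pi ^ 2 / (2 * (L / m) ^ 2) * (A + 6 * ε * (m : ℝ) ^ 3) + C := by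
        gcongr

/-! ### Small bookkeeping -/

/-- Splitting off `q = 0`: `Σ_q ν_q = ν_0 + Σ_{q ≠ 0} ν_q`. [folklore] -/
theorem sum_eq_zero_add_sum_filter (ν : (Fin 3 → Fin m) → ℝ) :
    ∑ q : Fin 3 → Fin m, ν q = ν 0 + ∑ q : Fin 3 → Fin m with (∃ k, (q k : ℕ) ≠ 0), ν q := by
  rw [← Finset.sum_filter_add_sum_filter_not Finset.univ (fun q : Fin 3 → Fin m => ∃ k, (q k : ℕ) ≠ 0),
    add_comm]
  congr 1
  have hset : (Finset.univ.filter fun q : Fin 3 → Fin m => ¬∃ k, (q k : ℕ) ≠ 0) = {0} := by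
    ext q
    simp only [Finset.mem_filter, Finset.mem_univ, true_and, not_exists, not_not,
      Finset.mem_singleton]
    constructor
    · intro h; funext k; exact Fin.ext (h k)
    · rintro rfl k; simp
  rw [hset, Finset.sum_singleton]

/-- **AM–GM on a finite index set**: `exp(mean log G) ≤ mean G` for `G > 0` (Jensen for `exp`).
[folklore] -/
theorem exp_mean_log_le_mean {ι : Type*} [Fintype ι] [Nonempty ι] (G : ι → ℝ) (hG : ∀ j, 0 < G j) :
    Real.exp ((∑ j, Real.log (G j)) / Fintype.card ι) ≤ (∑ j, G j) / Fintype.card ι := by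
  have hcard : (0 : ℝ) < Fintype.card ι := Nat.cast_pos.2 Fintype.card_pos
  have h := ConvexOn.map_sum_le convexOn_exp (t := Finset.univ)
    (w := fun _ => (1 : ℝ) / Fintype.card ι) (p := fun j => Real.log (G j))
    (fun _ _ => by positivity) (by
      rw [Finset.sum_const, Finset.card_univ, nsmul_eq_mul]; field_simp)
    (fun _ _ => Set.mem_univ _)
  simp only [smul_eq_mul] at h
  have hl : (∑ j, Real.log (G j)) / Fintype.card ι = ∑ j, 1 / (Fintype.card ι : ℝ) * Real.log (G j) := by
    rw [Finset.sum_div]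
    exact Finset.sum_congr rfl fun j _ => by ring
  have hr : (∑ j, G j) / Fintype.card ι = ∑ j, 1 / (Fintype.card ι : ℝ) * Real.exp (Real.log (G j)) := by
    rw [Finset.sum_div]
    exact Finset.sum_congr rfl fun j _ => by rw [Real.exp_log (hG j)]; ring
  rw [hl, hr]
  exact h

/-- The grid node `e_a`: `latticeVec h e_a = h e_a`. [folklore] -/
theorem latticeVec_single_one (hm : 2 ≤ m) (h : ℝ) (a : Fin 3) :
    latticeVec h (fun k => (((Pi.single a (1 : Fin m) : Fin 3 → Fin m) k : ℕ) : ℤ)) =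
      h • EuclideanSpace.single a (1 : ℝ) := by
  ext k
  rw [latticeVec, PiLp.toLp_apply, PiLp.smul_apply, EuclideanSpace.single, PiLp.single_apply,
    smul_eq_mul]
  by_cases hka : k = a
  · subst hka
    rw [Pi.single_eq_same, val_one_of_two_le hm, if_pos rfl]
    simp
  · rw [Pi.single_eq_of_ne hka, if_neg hka]
    simp

/-- The grid node `-e_a`: `latticeVec h (-e_a) = -h e_a + (hm) e_a`. [folklore] -/
theorem latticeVec_single_neg_one (hm : 2 ≤ m) (h : ℝ) (a : Fin 3) :
    latticeVec h (fun k => (((Pi.single a (-1 : Fin m) : Fin 3 → Fin m) k : ℕ) : ℤ)) =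
      (-h) • EuclideanSpace.single a (1 : ℝ) + EuclideanSpace.single a (h * m) := by
  ext k
  rw [latticeVec, PiLp.toLp_apply, PiLp.add_apply, PiLp.smul_apply, EuclideanSpace.single,
    PiLp.single_apply, EuclideanSpace.single, PiLp.single_apply, smul_eq_mul]
  by_cases hka : k = a
  · subst hka
    rw [Pi.single_eq_same, val_neg_one_of_two_le hm, if_pos rfl, if_pos rfl, Nat.cast_sub (by omega)]
    push_cast
    ring
  · rw [Pi.single_eq_of_ne hka, if_neg hka, if_neg hka]
    simp

end Summit.AtomisticToContinuum.BoseEinsteinCondensation.Theorems.InfDivGlue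

end
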